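import Summits.QuantumFields.GaugeBoot.PairLoopClasses
import Summits.QuantumFields.GaugeBoot.SU3KinematicalRows
import HarnessLib

/-!
# Positioned pairs of loops, COMPLEX double traces: the symmetry class of `E[tr hol A · tr hol B]` (cell `gauge-boot`)

Honest framing (cell rule): certified bounds on lattice expectations at stated coupling, gauge group, dimension and
torus size; NOT a mass gap, NOT a continuum limit, NOT a string tension, NOT large `N`; not summit-bearing
(`FixedCouplingUltralocality`, `PerturbativeInvisibility`).  This file enters NO bound, NO certificate and NO index
row; it is a desk item of seat lean2 (task L1 lane: the loop equations in the generators' normal form).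

`PairLoopClasses.lean` identifies the REAL pair expectation `pairExp ρ β L p q = ⟨W_p · W_q⟩` (`W = (1/N) Re tr`)
along `decide`-checked scripts of moves `PMove` (joint translation / axis permutation / reflection of axis `0`;
per-component reversal, one-letter rotation, free reduction).  For `SU(2)` that is the generators' pair variable.
For `N ≥ 3` the pair variable of the single-link Schwinger–Dyson rows (`LoopEquationPairForm.lean`: `d(A, B) =
Re E[tr hol A · tr hol B] / N²`) and of the kinematical rows (`SU3KinematicalRows.lean`) is the COMPLEX double trace,
for which a single reversal is NOT a symmetry (`tr hol(A⁻¹) = conj tr hol A`; `E[conj tr A · tr B] ≠ E[tr A · tr B]`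
in general), while the JOINT reversal of both components is (charge conjugation, `ConjugationSymmetry.lean`).
This file provides the identification of complex double traces, script-style and with NO new definition
(the positioned loops `PLoop`, the moves `PMove`, `PMove.run` and the decidable side condition
`PMove.closedAlong` are those of `PairLoopClasses.lean`):

* for any compact `G` and continuous `ρ`, the complex pair expectation
  `∫ tr ρ(hol_{p} p.word) · tr ρ(hol_{q} q.word) dμ_β` (base points cast from `ℤ^d` by `castZ`) is invariant under
  joint translation (`integral_trace_mul_trace_shift`, and `_translate` for torus base points), joint axis
  permutation (`_perm`), joint reflection of axis `0` (`_refl0`), rotation of a closed component (`_rot_left`,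
  pointwise `trace_wordHolonomy_rotate`), free reduction of a component (`_red_left`), swap (`_comm`); hence under
  ONE move other than `revL` / `revR` (`integral_trace_mul_trace_pmove`) and along any script without single
  reversals (`integral_trace_mul_trace_run`, master lemma `integral_trace_mul_trace_eq_of_run`, and its base-point-`0`
  form `integral_trace_mul_trace_eq_of_run_zero` — the script and its side conditions are ONE `decide`, the absence
  of `revL` / `revR` is ONE `simp`);
* for lattice `SU(N)` (fundamental representation, every `N`, every real `β`, every `d`, every `L ≥ 1`): JOINT
  reversal of two closed components does not change the complex pair expectation
  (`integral_trace_rev_mul_trace_rev_specialUnitaryGroup`, `…_ploop`; from `SU3KinematicalRows`: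
  `E[tr A⁻¹ · tr B⁻¹] = conj E[tr A · tr B]` and `Im E[tr A · tr B] = 0`), so a script may be preceded by a joint
  reversal (`integral_trace_mul_trace_eq_of_run_rev_zero`).
This is exactly the canonicalisation group of the generators' `SU(3)` pair labels (eng1 G1 / eng2 G2
`canonical_multiloop(…, independent_reversal=False)`: global translation × `B_d` × joint reversal, independent
rotation and reduction); instance bookkeeping (which pairs, canonical labels, orbit sizes) remains the generators'.
Everything is `[folklore]` (cyclicity of the trace, invariance of Haar measure and of the Wilson action under the
lattice symmetries and under `U ↦ Ū`; Montvay–Münster §3.2; Kazakov–Zheng arXiv:2404.16925 §2; Guo–Li–Yang–Zhu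
arXiv:2502.14421 §2).
-/

noncomputable section

open MeasureTheory
open scoped Matrix ComplexConjugate
open Literature.MathematicalPhysics.QuantumFieldTheory
open Literature.MathematicalPhysics.QuantumLattice

namespace Summit.QuantumFields.GaugeBoot

/-! ## Pointwise: cyclic rotation of a closed word does not change the trace of its holonomy -/

section Pointwise

variable {d L N : ℕ} {G : Type*} [Group G] (ρ : G →* Matrix (Fin N) (Fin N) ℂ)

/-- **Cyclicity of the trace**: for a CLOSED word `s · w` at `x`, `tr ρ(hol_x(s · w)) = tr ρ(hol_{x+s}(w · s))`
(first letter moved to the end, base point moved along it). [folklore] -/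
theorem trace_wordHolonomy_rotate (U : GaugeConfig d L G) (x : Site d L) (s : Step d) (w : Word d)
    (hw : Word.endpoint x (s :: w) = x) :
    (ρ (wordHolonomy U x (s :: w))).trace = (ρ (wordHolonomy U (s.apply x) (w ++ [s]))).trace := by
  have hend : Word.endpoint (s.apply x) w = x := by simpa using hw
  simp only [wordHolonomy_cons, wordHolonomy_append, hend, wordHolonomy_nil, mul_one, map_mul]
  rw [Matrix.trace_mul_comm]

end Pointwise

/-! ## The complex pair expectation along the moves (any compact `G`, any continuous `ρ`) -/

section Moves

variable {d L N : ℕ} [NeZero L] {G : Type*} [Group G] [TopologicalSpace G] [IsTopologicalGroup G]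
  [CompactSpace G] [MeasurableSpace G] [BorelSpace G] (ρ : G →* Matrix (Fin N) (Fin N) ℂ)

/-- **Swap**: `E[tr hol_x A · tr hol_y B] = E[tr hol_y B · tr hol_x A]`. [folklore] -/
theorem integral_trace_mul_trace_comm (β : ℝ) (x y : Site d L) (v w : Word d) :
    ∫ U, (ρ (wordHolonomy U x v)).trace * (ρ (wordHolonomy U y w)).trace
        ∂(wilsonMeasure (d := d) (L := L) ρ β) =
      ∫ U, (ρ (wordHolonomy U y w)).trace * (ρ (wordHolonomy U x v)).trace
        ∂(wilsonMeasure (d := d) (L := L) ρ β) := by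
  simp_rw [mul_comm]

open TorusTranslation in
/-- **Joint translation invariance (torus base points)**: `E[tr hol_{x+v} A · tr hol_{y+v} B] = E[tr hol_x A · tr hol_y B]`
(tree `wilsonExpectation_comp_torusConfigShift`). [folklore] -/
theorem integral_trace_mul_trace_translate (β : ℝ) (v x y : Site d L) (A B : Word d) :
    ∫ U, (ρ (wordHolonomy U (x + v) A)).trace * (ρ (wordHolonomy U (y + v) B)).trace
        ∂(wilsonMeasure (d := d) (L := L) ρ β) =
      ∫ U, (ρ (wordHolonomy U x A)).trace * (ρ (wordHolonomy U y B)).trace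
        ∂(wilsonMeasure (d := d) (L := L) ρ β) := by
  have h := wilsonExpectation_comp_torusConfigShift (d := d) (L := L) (G := G) ρ β v
    (fun U => (ρ (wordHolonomy U (x + v) A)).trace * (ρ (wordHolonomy U (y + v) B)).trace)
  unfold wilsonExpectation at h
  rw [← h]
  congr 1
  funext U
  simp only [Function.comp_apply, wordHolonomy_torusConfigShift, add_sub_cancel_right]

open TorusTranslation in
/-- **Joint translation invariance** for positioned pairs (integer base points). [folklore] -/
theorem integral_trace_mul_trace_shift (β : ℝ) (t : Fin d → ℤ) (p q : PLoop d) :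
    ∫ U, (ρ (wordHolonomy U (castZ (p.shift t).base) (p.shift t).word)).trace *
          (ρ (wordHolonomy U (castZ (q.shift t).base) (q.shift t).word)).trace
        ∂(wilsonMeasure (d := d) (L := L) ρ β) =
      ∫ U, (ρ (wordHolonomy U (castZ p.base) p.word)).trace * (ρ (wordHolonomy U (castZ q.base) q.word)).trace
        ∂(wilsonMeasure (d := d) (L := L) ρ β) := by
  simp only [PLoop.shift]
  have h := wilsonExpectation_comp_torusConfigShift (d := d) (L := L) (G := G) ρ β (castZ t)
    (fun U => (ρ (wordHolonomy U (castZ (p.base + t)) p.word)).trace *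
      (ρ (wordHolonomy U (castZ (q.base + t)) q.word)).trace)
  unfold wilsonExpectation at h
  rw [← h]
  congr 1
  funext U
  simp only [Function.comp_apply, wordHolonomy_torusConfigShift, castZ_add, add_sub_cancel_right]

/-- **Joint axis-permutation invariance** (continuous `ρ`; tree `wilsonExpectation_comp_configPerm`). [folklore] -/
theorem integral_trace_mul_trace_perm (hρ : Continuous ρ) (β : ℝ) (π : Equiv.Perm (Fin d)) (p q : PLoop d) :
    ∫ U, (ρ (wordHolonomy U (castZ (p.perm π).base) (p.perm π).word)).trace *
          (ρ (wordHolonomy U (castZ (q.perm π).base) (q.perm π).word)).trace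
        ∂(wilsonMeasure (d := d) (L := L) ρ β) =
      ∫ U, (ρ (wordHolonomy U (castZ p.base) p.word)).trace * (ρ (wordHolonomy U (castZ q.base) q.word)).trace
        ∂(wilsonMeasure (d := d) (L := L) ρ β) := by
  simp only [PLoop.perm]
  have h := wilsonExpectation_comp_configPerm (d := d) (L := L) (G := G) ρ hρ β π
    (fun U => (ρ (wordHolonomy U (castZ (PLoop.permZ π p.base)) (p.word.map (Step.permute π)))).trace *
      (ρ (wordHolonomy U (castZ (PLoop.permZ π q.base)) (q.word.map (Step.permute π)))).trace)
  unfold wilsonExpectation at h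
  rw [← h]
  congr 1
  funext U
  have hx : ∀ b : Fin d → ℤ, sitePerm π.symm (castZ (PLoop.permZ π b) : Site d L) = castZ b := fun b => by
    rw [← sitePerm_castZ]; ext k; simp
  have hw : ∀ w : Word d, (w.map (Step.permute π)).map (Step.permute π.symm) = w := fun w => by
    rw [List.map_map]
    conv_rhs => rw [← List.map_id w]
    exact List.map_congr_left fun s _ => by simp
  simp only [Function.comp_apply, wordHolonomy_configPerm, hx, hw]

/-- **Rotation of a closed component by one letter** (pointwise, `trace_wordHolonomy_rotate`). [folklore] -/
theorem integral_trace_mul_trace_rot_left (β : ℝ) (p q : PLoop d) (hp : p.Closed) :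
    ∫ U, (ρ (wordHolonomy U (castZ p.rot.base) p.rot.word)).trace * (ρ (wordHolonomy U (castZ q.base) q.word)).trace
        ∂(wilsonMeasure (d := d) (L := L) ρ β) =
      ∫ U, (ρ (wordHolonomy U (castZ p.base) p.word)).trace * (ρ (wordHolonomy U (castZ q.base) q.word)).trace
        ∂(wilsonMeasure (d := d) (L := L) ρ β) := by
  unfold PLoop.rot
  rcases p with ⟨b, w⟩
  cases w with
  | nil => rfl
  | cons s w =>
    simp only
    rw [castZ_add_disp]
    simp only [← trace_wordHolonomy_rotate ρ _ (castZ b) s w (Word.endpoint_eq_self_of_disp _ hp)]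

/-- **Free reduction of a component** (pointwise, `wordHolonomy_freeReduce`). [folklore] -/
theorem integral_trace_mul_trace_red_left (β : ℝ) (p q : PLoop d) :
    ∫ U, (ρ (wordHolonomy U (castZ p.red.base) p.red.word)).trace * (ρ (wordHolonomy U (castZ q.base) q.word)).trace
        ∂(wilsonMeasure (d := d) (L := L) ρ β) =
      ∫ U, (ρ (wordHolonomy U (castZ p.base) p.word)).trace * (ρ (wordHolonomy U (castZ q.base) q.word)).trace
        ∂(wilsonMeasure (d := d) (L := L) ρ β) := by
  simp only [PLoop.red, wordHolonomy_freeReduce]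

end Moves

/-! ## Scripts without single reversals -/

section Scripts

variable {d L N : ℕ} [NeZero d] [NeZero L] {G : Type*} [Group G] [TopologicalSpace G] [IsTopologicalGroup G]
  [CompactSpace G] [MeasurableSpace G] [BorelSpace G] (ρ : G →* Matrix (Fin N) (Fin N) ℂ)

/-- **Joint reflection invariance** (axis `0`; continuous `ρ`; tree `wilsonExpectation_comp_negReflect`). [folklore] -/
theorem integral_trace_mul_trace_refl0 (hρ : Continuous ρ) (β : ℝ) (p q : PLoop d) :
    ∫ U, (ρ (wordHolonomy U (castZ p.refl0.base) p.refl0.word)).trace *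
          (ρ (wordHolonomy U (castZ q.refl0.base) q.refl0.word)).trace
        ∂(wilsonMeasure (d := d) (L := L) ρ β) =
      ∫ U, (ρ (wordHolonomy U (castZ p.base) p.word)).trace * (ρ (wordHolonomy U (castZ q.base) q.word)).trace
        ∂(wilsonMeasure (d := d) (L := L) ρ β) := by
  simp only [PLoop.refl0]
  have h := wilsonExpectation_comp_negReflect (d := d) (L := L) (G := G) ρ hρ β
    (fun U => (ρ (wordHolonomy U (castZ (PLoop.refl0Z p.base)) (p.word.map Step.reflect0))).trace *
      (ρ (wordHolonomy U (castZ (PLoop.refl0Z q.base)) (q.word.map Step.reflect0))).trace)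
  unfold wilsonExpectation at h
  rw [← h]
  congr 1
  funext U
  have hx : ∀ b : Fin d → ℤ, (castZ (PLoop.refl0Z b) : Site d L).negReflect = castZ b := fun b => by
    rw [← negReflect_castZ, WilsonSiteRP.negReflect_negReflect]
  have hw : ∀ w : Word d, (w.map Step.reflect0).map Step.reflect0 = w := fun w => by
    rw [List.map_map]
    conv_rhs => rw [← List.map_id w]
    exact List.map_congr_left fun s _ => by simp
  simp only [Function.comp_apply, wordHolonomy_negReflect, hx, hw]

/-- **One move other than a single reversal preserves the complex pair expectation** (its side condition
`PMove.ok` — rotation only of a closed component — being met). [folklore] -/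
theorem integral_trace_mul_trace_pmove (hρ : Continuous ρ) (β : ℝ) (m : PMove d) (pq : PLoop d × PLoop d)
    (hm : m.ok pq) (h₁ : m ≠ PMove.revL) (h₂ : m ≠ PMove.revR) :
    ∫ U, (ρ (wordHolonomy U (castZ (m.apply pq).1.base) (m.apply pq).1.word)).trace *
          (ρ (wordHolonomy U (castZ (m.apply pq).2.base) (m.apply pq).2.word)).trace
        ∂(wilsonMeasure (d := d) (L := L) ρ β) =
      ∫ U, (ρ (wordHolonomy U (castZ pq.1.base) pq.1.word)).trace * (ρ (wordHolonomy U (castZ pq.2.base) pq.2.word)).trace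
        ∂(wilsonMeasure (d := d) (L := L) ρ β) := by
  rcases pq with ⟨p, q⟩
  cases m with
  | shift t => exact integral_trace_mul_trace_shift ρ β t p q
  | perm π => exact integral_trace_mul_trace_perm ρ hρ β π p q
  | refl0 => exact integral_trace_mul_trace_refl0 ρ hρ β p q
  | revL => exact absurd rfl h₁
  | revR => exact absurd rfl h₂
  | rotL => exact integral_trace_mul_trace_rot_left ρ β p q hm
  | rotR =>
    dsimp only [PMove.apply]
    rw [integral_trace_mul_trace_comm ρ β _ _ p.word q.rot.word, integral_trace_mul_trace_rot_left ρ β q p hm,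
      integral_trace_mul_trace_comm ρ β _ _ q.word p.word]
  | redL => exact integral_trace_mul_trace_red_left ρ β p q
  | redR =>
    dsimp only [PMove.apply]
    rw [integral_trace_mul_trace_comm ρ β _ _ p.word q.red.word, integral_trace_mul_trace_red_left ρ β q p,
      integral_trace_mul_trace_comm ρ β _ _ q.word p.word]

/-- **A script without single reversals preserves the complex pair expectation** (side conditions along the run,
`PMove.closedAlong`, decidable). [folklore] -/
theorem integral_trace_mul_trace_run (hρ : Continuous ρ) (β : ℝ) :
    ∀ (ms : List (PMove d)) (pq : PLoop d × PLoop d), PMove.closedAlong ms pq →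
      (∀ m ∈ ms, m ≠ PMove.revL ∧ m ≠ PMove.revR) →
      ∫ U, (ρ (wordHolonomy U (castZ (PMove.run ms pq).1.base) (PMove.run ms pq).1.word)).trace *
            (ρ (wordHolonomy U (castZ (PMove.run ms pq).2.base) (PMove.run ms pq).2.word)).trace
          ∂(wilsonMeasure (d := d) (L := L) ρ β) =
        ∫ U, (ρ (wordHolonomy U (castZ pq.1.base) pq.1.word)).trace *
            (ρ (wordHolonomy U (castZ pq.2.base) pq.2.word)).trace
          ∂(wilsonMeasure (d := d) (L := L) ρ β)
  | [], _, _, _ => rfl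
  | m :: ms, pq, h, hj => by
    have hm : m ≠ PMove.revL ∧ m ≠ PMove.revR := hj m (by simp)
    rw [PMove.run, integral_trace_mul_trace_run hρ β ms (m.apply pq) h.2
        (fun m' hm' => hj m' (List.mem_cons_of_mem m hm')),
      integral_trace_mul_trace_pmove ρ hρ β m pq h.1 hm.1 hm.2]

/-- **Master identification lemma for complex double traces.** Two positioned pairs joined by a checked script
WITHOUT single reversals (`h` by `decide`, `hj` by `simp`) have the same complex pair expectation on every torus and
at every coupling. [folklore] -/
theorem integral_trace_mul_trace_eq_of_run (hρ : Continuous ρ) (β : ℝ) (ms : List (PMove d))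
    (p q p' q' : PLoop d) (h : PMove.closedAlong ms (p, q) ∧ PMove.run ms (p, q) = (p', q'))
    (hj : ∀ m ∈ ms, m ≠ PMove.revL ∧ m ≠ PMove.revR) :
    ∫ U, (ρ (wordHolonomy U (castZ p.base) p.word)).trace * (ρ (wordHolonomy U (castZ q.base) q.word)).trace
        ∂(wilsonMeasure (d := d) (L := L) ρ β) =
      ∫ U, (ρ (wordHolonomy U (castZ p'.base) p'.word)).trace * (ρ (wordHolonomy U (castZ q'.base) q'.word)).trace
        ∂(wilsonMeasure (d := d) (L := L) ρ β) := by
  have := integral_trace_mul_trace_run (L := L) ρ hρ β ms (p, q) h.1 hj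
  rw [h.2] at this
  exact this.symm

/-- **Base point `0` form**: a pair of words read from the origin, carried by a checked script without single
reversals to the positioned pair `(p', q')`:
`E[tr hol_0 A · tr hol_0 B] = E[tr hol_{p'.base} p'.word · tr hol_{q'.base} q'.word]`. [folklore] -/
theorem integral_trace_mul_trace_eq_of_run_zero (hρ : Continuous ρ) (β : ℝ) (ms : List (PMove d))
    (A B : Word d) (p' q' : PLoop d)
    (h : PMove.closedAlong ms (⟨0, A⟩, ⟨0, B⟩) ∧ PMove.run ms (⟨0, A⟩, ⟨0, B⟩) = (p', q'))
    (hj : ∀ m ∈ ms, m ≠ PMove.revL ∧ m ≠ PMove.revR) :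
    ∫ U, (ρ (wordHolonomy U (0 : Site d L) A)).trace * (ρ (wordHolonomy U (0 : Site d L) B)).trace
        ∂(wilsonMeasure (d := d) (L := L) ρ β) =
      ∫ U, (ρ (wordHolonomy U (castZ p'.base) p'.word)).trace * (ρ (wordHolonomy U (castZ q'.base) q'.word)).trace
        ∂(wilsonMeasure (d := d) (L := L) ρ β) := by
  have := integral_trace_mul_trace_eq_of_run (L := L) ρ hρ β ms ⟨0, A⟩ ⟨0, B⟩ p' q' h hj
  simpa only [castZ_zero] using this

end Scripts

/-! ## Lattice `SU(N)`: joint reversal -/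

section SpecialUnitary

variable (N : ℕ) {d L : ℕ} [NeZero L]

/-- **Joint reversal does not change the complex pair expectation** in lattice `SU(N)`: for closed words `A` at `x`
and `B` at `y`, `E[tr hol_x A⁻¹ · tr hol_y B⁻¹] = E[tr hol_x A · tr hol_y B]` — it is the complex conjugate
(`integral_trace_reverse_mul_trace_reverse_closed`) of a real number (`im_integral_trace_mul_trace_eq_zero`, charge
conjugation).  A SINGLE reversal is not a symmetry for `N ≥ 3`. [folklore] -/
theorem integral_trace_rev_mul_trace_rev_specialUnitaryGroup (β : ℝ) (x y : Site d L) (v w : Word d)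
    (hv : Word.endpoint x v = x) (hw : Word.endpoint y w = y) :
    ∫ U, (fundamentalRep (Fin N) (wordHolonomy U x (Word.reverse v))).trace *
          (fundamentalRep (Fin N) (wordHolonomy U y (Word.reverse w))).trace
        ∂(wilsonMeasure (d := d) (L := L) (fundamentalRep (Fin N)) β) =
      ∫ U, (fundamentalRep (Fin N) (wordHolonomy U x v)).trace * (fundamentalRep (Fin N) (wordHolonomy U y w)).trace
        ∂(wilsonMeasure (d := d) (L := L) (fundamentalRep (Fin N)) β) := by
  rw [integral_trace_reverse_mul_trace_reverse_closed N β x y v w hv hw]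
  exact Complex.conj_eq_iff_im.mpr (im_integral_trace_mul_trace_eq_zero N β x y v w)

/-- Joint reversal of two CLOSED positioned loops does not change the complex pair expectation (lattice `SU(N)`).
[folklore] -/
theorem integral_trace_rev_mul_trace_rev_ploop (β : ℝ) (p q : PLoop d) (hp : p.Closed) (hq : q.Closed) :
    ∫ U, (fundamentalRep (Fin N) (wordHolonomy U (castZ p.rev.base) p.rev.word)).trace *
          (fundamentalRep (Fin N) (wordHolonomy U (castZ q.rev.base) q.rev.word)).trace
        ∂(wilsonMeasure (d := d) (L := L) (fundamentalRep (Fin N)) β) =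
      ∫ U, (fundamentalRep (Fin N) (wordHolonomy U (castZ p.base) p.word)).trace *
          (fundamentalRep (Fin N) (wordHolonomy U (castZ q.base) q.word)).trace
        ∂(wilsonMeasure (d := d) (L := L) (fundamentalRep (Fin N)) β) :=
  integral_trace_rev_mul_trace_rev_specialUnitaryGroup N β _ _ p.word q.word
    (Word.endpoint_eq_self_of_disp _ hp) (Word.endpoint_eq_self_of_disp _ hq)

/-- **Base point `0` form with a joint reversal first** (lattice `SU(N)`): closed words `A`, `B` read from the origin,
both reversed, then carried by a checked script without single reversals to `(p', q')`:
`E[tr hol_0 A · tr hol_0 B] = E[tr hol_{p'.base} p'.word · tr hol_{q'.base} q'.word]`. [folklore] -/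
theorem integral_trace_mul_trace_eq_of_run_rev_zero [NeZero d] (β : ℝ) (ms : List (PMove d)) (A B : Word d)
    (p' q' : PLoop d) (hAB : Word.disp A = 0 ∧ Word.disp B = 0)
    (h : PMove.closedAlong ms (⟨0, Word.reverse A⟩, ⟨0, Word.reverse B⟩) ∧
      PMove.run ms (⟨0, Word.reverse A⟩, ⟨0, Word.reverse B⟩) = (p', q'))
    (hj : ∀ m ∈ ms, m ≠ PMove.revL ∧ m ≠ PMove.revR) :
    ∫ U, (fundamentalRep (Fin N) (wordHolonomy U (0 : Site d L) A)).trace *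
          (fundamentalRep (Fin N) (wordHolonomy U (0 : Site d L) B)).trace
        ∂(wilsonMeasure (d := d) (L := L) (fundamentalRep (Fin N)) β) =
      ∫ U, (fundamentalRep (Fin N) (wordHolonomy U (castZ p'.base) p'.word)).trace *
          (fundamentalRep (Fin N) (wordHolonomy U (castZ q'.base) q'.word)).trace
        ∂(wilsonMeasure (d := d) (L := L) (fundamentalRep (Fin N)) β) := by
  rw [← integral_trace_rev_mul_trace_rev_specialUnitaryGroup N β (0 : Site d L) 0 A B
    (Word.endpoint_eq_self_of_disp _ hAB.1) (Word.endpoint_eq_self_of_disp _ hAB.2)]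
  exact integral_trace_mul_trace_eq_of_run_zero (fundamentalRep (Fin N)) (continuous_fundamentalRep (Fin N)) β ms
    (Word.reverse A) (Word.reverse B) p' q' h hj

end SpecialUnitary

end Summit.QuantumFields.GaugeBoot

end
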